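import Summits.AtomisticToContinuum.Crystallization.Theorems.FrustratedLawDichotomyKissingPatternCombinatorics

/-!
# FrustratedLawDichotomy · crux `AperiodicFrustratedLawGap` (stmt-AtomisticToContinuum-27623) — `LinkIso` TOOLKIT: neighbour sets, common
# neighbours and ring numbers under a link isomorphism; a classified link is charge-free (decomp-a2c, prover hand 2, gen 9)

Lens-5's `LinkIso θ Pat y i τ` (p820342) says: `τ` lands in the θ-bonded neighbours of `i`, hits all of them, and carries pattern contacts
exactly onto θ-bonds.  The P-prover (`CapForcing`: «the common bond-neighbours of `i` and `τ w` are `τ` of the four contacts of `w`») and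
every consumer of G needs the following bookkeeping, proved here once (def-free):

* `neighborSet_eq_range` : `N(i) = range τ`;  `injective_of_linkIso` : `τ` is injective when the contact graph of `Pat` separates points
  (fcc / hcp: `fcc_/hcp_contactSeparating`, p820589);  `ncard_neighborSet_eq` : `#N(i) = |Pat|`;
* `commonNeighbors_eq_image` : `N(i) ∩ N(τ u) = τ '' {v | dist u v = 1}` — the ring around the bond `{i, τ u}` IS the contact set of `u`;
* `ringNumber_eq_ncard_contacts` : `ringNumber θ y i (τ u) = #{v | dist u v = 1}`;
* `isChargeFree_of_linkIso` : `|Pat| = 12`, every pattern point has `4` contacts, `τ` injective, `LinkIso` ⟹ `IsChargeFree θ y i`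
  (the converse direction of G: a site with an fcc- or hcp-classified link IS charge-free — `isChargeFree_of_linkIso_fcc / _hcp`, using the
  `decide`d contact counts `fccInt_card_contacts` / `hcpInt_card_contacts` of p821347 transported to the real patterns
  (`fcc_ncard_contacts`, `hcp_ncard_contacts`)).
`[folklore]`; def-free; no `sorry`.
-/

noncomputable section

namespace Summit.AtomisticToContinuum.Crystallization.Theorems.FrustratedLawDichotomyLinkIsoToolkit

open Literature.Geometry.DiscreteGeometry
open Summit.AtomisticToContinuum.Crystallization.Theorems.FrustratedLawDichotomyTwoShellRigidityCut (E3 LinkIso)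
open Summit.AtomisticToContinuum.Crystallization.Theorems.FrustratedLawDichotomyCappedRigidityCertPatterns
  (dist_eq_one_iff_sqNormInt fcc_contactSeparating hcp_contactSeparating)
open Summit.AtomisticToContinuum.Crystallization.Theorems.FrustratedLawDichotomyKissingPatternCombinatorics
  (fccInt_card_contacts hcpInt_card_contacts)

variable {θ : ℝ} {Pat : Finset E3} {N : ℕ} {y : Fin N → E3} {i : Fin N} {τ : ↥Pat → Fin N}

/-- Under a link isomorphism the θ-neighbours of `i` are exactly the `τ u`. [folklore] -/
theorem neighborSet_eq_range (hL : LinkIso θ Pat y i τ) : (bondGraph θ y).neighborSet i = Set.range τ := by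
  ext k
  rw [SimpleGraph.mem_neighborSet]
  constructor
  · intro hk
    obtain ⟨u, hu⟩ := hL.2.1 k hk
    exact ⟨u, hu⟩
  · rintro ⟨u, rfl⟩
    exact hL.1 u

/-- A link vertex is not the centre. [folklore] -/
theorem ne_centre_of_linkIso (hL : LinkIso θ Pat y i τ) (u : ↥Pat) : τ u ≠ i := fun h => (hL.1 u).ne h.symm

/-- `τ` is injective as soon as the contact graph of `Pat` separates points. [folklore] -/
theorem injective_of_linkIso
    (hPat : ∀ u v : ↥Pat, u ≠ v → ∃ w : ↥Pat, dist (u : E3) (w : E3) = 1 ∧ dist (v : E3) (w : E3) ≠ 1)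
    (hL : LinkIso θ Pat y i τ) : Function.Injective τ := by
  intro u v huv
  by_contra hne
  obtain ⟨w, huw, hvw⟩ := hPat u v hne
  have h1 : (bondGraph θ y).Adj (τ u) (τ w) := (hL.2.2 u w).2 huw
  rw [huv] at h1
  exact hvw ((hL.2.2 v w).1 h1)

/-- **The ring around the bond `{i, τ u}` is the contact set of `u`**: `N(i) ∩ N(τ u) = τ '' {v | dist u v = 1}`. [folklore] -/
theorem commonNeighbors_eq_image (hL : LinkIso θ Pat y i τ) (u : ↥Pat) :
    (bondGraph θ y).neighborSet i ∩ (bondGraph θ y).neighborSet (τ u) = τ '' {v : ↥Pat | dist (u : E3) (v : E3) = 1} := by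
  ext k
  simp only [Set.mem_inter_iff, SimpleGraph.mem_neighborSet, Set.mem_image, Set.mem_setOf_eq]
  constructor
  · rintro ⟨hik, huk⟩
    obtain ⟨v, rfl⟩ := hL.2.1 k hik
    exact ⟨v, (hL.2.2 u v).1 huk, rfl⟩
  · rintro ⟨v, hv, rfl⟩
    exact ⟨hL.1 v, (hL.2.2 u v).2 hv⟩

/-- The ring number of the bond `{i, τ u}` is the number of contacts of `u` in the pattern (for `τ` injective). [folklore] -/
theorem ringNumber_eq_ncard_contacts (hτ : Function.Injective τ) (hL : LinkIso θ Pat y i τ) (u : ↥Pat) :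
    ringNumber θ y i (τ u) = ({v : ↥Pat | dist (u : E3) (v : E3) = 1} : Set ↥Pat).ncard := by
  rw [ringNumber_def, commonNeighbors_eq_image hL u, Set.ncard_image_of_injective _ hτ]

/-- `#N(i) = |Pat|` (for `τ` injective). [folklore] -/
theorem ncard_neighborSet_eq (hτ : Function.Injective τ) (hL : LinkIso θ Pat y i τ) :
    ((bondGraph θ y).neighborSet i).ncard = Pat.card := by
  rw [neighborSet_eq_range hL, Set.ncard_range_of_injective hτ, Nat.card_eq_fintype_card, Fintype.card_coe]

/-- **A classified link is charge-free**: `|Pat| = 12`, four contacts at every pattern point, `τ` injective, `LinkIso` ⟹ `IsChargeFree`.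
[folklore] -/
theorem isChargeFree_of_linkIso (hcard : Pat.card = 12)
    (h4 : ∀ u : ↥Pat, ({v : ↥Pat | dist (u : E3) (v : E3) = 1} : Set ↥Pat).ncard = 4)
    (hτ : Function.Injective τ) (hL : LinkIso θ Pat y i τ) : IsChargeFree θ y i := by
  refine ⟨by rw [ncard_neighborSet_eq hτ hL, hcard], fun j hj => ?_⟩
  rw [neighborSet_eq_range hL] at hj
  obtain ⟨u, rfl⟩ := hj
  rw [ringNumber_eq_ncard_contacts hτ hL u, h4 u]

/-! ### The contact counts of the two kissing patterns, transported from the integer models -/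

/-- Transport of a contact count from the integer model `S` (scale `N₀`) to the scaled pattern. [folklore] -/
theorem ncard_contacts_scaledPattern {S : Finset (Fin 3 → ℤ)} {N₀ : ℕ} (hN : N₀ ≠ 0) {n : ℕ}
    (hS : ∀ v ∈ S, (S.filter (fun w => sqNormInt (v - w) = N₀)).card = n) (u : ↥(scaledPattern S N₀)) :
    ({v : ↥(scaledPattern S N₀) | dist (u : E3) (v : E3) = 1} : Set ↥(scaledPattern S N₀)).ncard = n := by
  classical
  have hu := u.2
  simp only [scaledPattern, Finset.mem_image] at hu
  obtain ⟨v₀, hv₀, hvu⟩ := hu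
  set f : (Fin 3 → ℤ) → E3 := fun z => (Real.sqrt N₀)⁻¹ • intVec z with hf
  have hfinj : Function.Injective f := scaledPattern_map_injective hN
  -- push the subtype set into `E3`
  have h1 : ({v : ↥(scaledPattern S N₀) | dist (u : E3) (v : E3) = 1} : Set ↥(scaledPattern S N₀)).ncard =
      (Subtype.val '' ({v : ↥(scaledPattern S N₀) | dist (u : E3) (v : E3) = 1} : Set ↥(scaledPattern S N₀))).ncard :=
    (Set.ncard_image_of_injective _ Subtype.val_injective).symm
  have h2 : Subtype.val '' ({v : ↥(scaledPattern S N₀) | dist (u : E3) (v : E3) = 1} : Set ↥(scaledPattern S N₀)) =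
      f '' (↑(S.filter (fun w => sqNormInt (v₀ - w) = N₀)) : Set (Fin 3 → ℤ)) := by
    ext x
    simp only [Set.mem_image, Set.mem_setOf_eq, Finset.coe_filter]
    constructor
    · rintro ⟨⟨x', hx'⟩, hd, rfl⟩
      have hx'' := hx'
      simp only [scaledPattern, Finset.mem_image] at hx''
      obtain ⟨z, hz, rfl⟩ := hx''
      refine ⟨z, ⟨hz, ?_⟩, rfl⟩
      rw [← hvu] at hd
      exact (dist_eq_one_iff_sqNormInt hN v₀ z).1 hd
    · rintro ⟨z, ⟨hz, hd⟩, rfl⟩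
      have hzmem : f z ∈ scaledPattern S N₀ := by
        simp only [scaledPattern, Finset.mem_image]
        exact ⟨z, hz, rfl⟩
      refine ⟨⟨f z, hzmem⟩, ?_, rfl⟩
      show dist (u : E3) (f z) = 1
      rw [← hvu]
      exact (dist_eq_one_iff_sqNormInt hN v₀ z).2 hd
  rw [h1, h2, Set.ncard_image_of_injective _ hfinj, Set.ncard_coe_finset, hS v₀ hv₀]

/-- fcc: every point of the fcc kissing pattern has exactly four contacts. [folklore] -/
theorem fcc_ncard_contacts (u : ↥fccKissingPattern) :
    ({v : ↥fccKissingPattern | dist (u : E3) (v : E3) = 1} : Set ↥fccKissingPattern).ncard = 4 :=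
  ncard_contacts_scaledPattern two_ne_zero fccInt_card_contacts u

/-- hcp: every point of the hcp kissing pattern has exactly four contacts. [folklore] -/
theorem hcp_ncard_contacts (u : ↥hcpKissingPattern) :
    ({v : ↥hcpKissingPattern | dist (u : E3) (v : E3) = 1} : Set ↥hcpKissingPattern).ncard = 4 :=
  ncard_contacts_scaledPattern (by norm_num) hcpInt_card_contacts u

/-- **An fcc-classified link is charge-free.** [folklore] -/
theorem isChargeFree_of_linkIso_fcc {τ : ↥fccKissingPattern → Fin N} (hL : LinkIso θ fccKissingPattern y i τ) :
    IsChargeFree θ y i :=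
  isChargeFree_of_linkIso card_fccKissingPattern fcc_ncard_contacts (injective_of_linkIso fcc_contactSeparating hL) hL

/-- **An hcp-classified link is charge-free.** [folklore] -/
theorem isChargeFree_of_linkIso_hcp {τ : ↥hcpKissingPattern → Fin N} (hL : LinkIso θ hcpKissingPattern y i τ) :
    IsChargeFree θ y i :=
  isChargeFree_of_linkIso card_hcpKissingPattern hcp_ncard_contacts (injective_of_linkIso hcp_contactSeparating hL) hL

/-! ### Two classified links sharing a bond: the four common neighbours seen from both ends (the P-prover's starting point) -/

/-- Under link isomorphisms at `i` (via `τ`) and at the neighbour `τ w` (via `τ'`), the centre `i` is a link vertex of `τ w`: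
`∃ w', τ' w' = i`. [folklore] -/
theorem exists_preimage_centre {Pat' : Finset E3} {τ' : ↥Pat' → Fin N} (hL : LinkIso θ Pat y i τ) (w : ↥Pat)
    (hL' : LinkIso θ Pat' y (τ w) τ') : ∃ w' : ↥Pat', τ' w' = i :=
  hL'.2.1 i (hL.1 w).symm

/-- **The four common neighbours, from both ends.**  Under link isomorphisms at `i` (via `τ : Pat → …`) and at `τ w` (via `τ' : Pat' → …`)
with `τ' w' = i`: `τ' '' {v' | dist w' v' = 1} = τ '' {v | dist w v = 1}` — the contacts of `w'` in the neighbour's pattern are carried onto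
the SAME four sites as the contacts of `w` in the centre's pattern (so `τ'` induces a bijection between the two 4-sets; whether it respects
the square-diagonal pairing is the crystal / twisted dichotomy of `CapForcing`). [folklore] -/
theorem image_contacts_eq_of_shared_bond {Pat' : Finset E3} {τ' : ↥Pat' → Fin N} (hL : LinkIso θ Pat y i τ) (w : ↥Pat)
    (hL' : LinkIso θ Pat' y (τ w) τ') {w' : ↥Pat'} (hw' : τ' w' = i) :
    τ' '' {v' : ↥Pat' | dist (w' : E3) (v' : E3) = 1} = τ '' {v : ↥Pat | dist (w : E3) (v : E3) = 1} := by
  rw [← commonNeighbors_eq_image hL w, ← commonNeighbors_eq_image hL' w', hw', Set.inter_comm]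

/-- In particular both 4-sets have the same size: `#contacts(w') = #contacts(w)` (for `τ, τ'` injective). [folklore] -/
theorem ncard_contacts_eq_of_shared_bond {Pat' : Finset E3} {τ' : ↥Pat' → Fin N} (hτ : Function.Injective τ)
    (hτ' : Function.Injective τ') (hL : LinkIso θ Pat y i τ) (w : ↥Pat) (hL' : LinkIso θ Pat' y (τ w) τ') {w' : ↥Pat'}
    (hw' : τ' w' = i) :
    ({v' : ↥Pat' | dist (w' : E3) (v' : E3) = 1} : Set ↥Pat').ncard = ({v : ↥Pat | dist (w : E3) (v : E3) = 1} : Set ↥Pat).ncard := by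
  rw [← Set.ncard_image_of_injective _ hτ', image_contacts_eq_of_shared_bond hL w hL' hw', Set.ncard_image_of_injective _ hτ]

end Summit.AtomisticToContinuum.Crystallization.Theorems.FrustratedLawDichotomyLinkIsoToolkit

end
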